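import Mathlib
import Summits.KontsevichZagierPeriods.KontsevichZagierPeriods.Theorems.SoloBlindWeilTraceGeneral

/-!
# Pointwise Gauss–Manin identity for the Weil-type families `y² = x(x²−a²)·h(x)` (solo-blind s63)

Companion of `SoloBlindWeilTraceGeneral` (the polynomial REDUCTION IDENTITY
`g(e)·X^α = (X − e)·Q_{α,e}(g) − e^α·((X − e)g′ − g)` and the trace / no-mixing identities, every
genus), which left the *analytic reading* uncertified.  Here that reading is certified POINTWISE on a
real gap — the form consumed by the determinant transport (LEMMA T′, THEOREM V_∞ step (A1);
`paper/weil-det.md` §2 (2.1)–(2.2), §10, §11 of the notes).  With `f_a = X(X²−a²)h` (`fam`),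
`g₊ = X(X+a)h`, `g₋ = X(X−a)h` (`gP`, `gM`), `G = 2a²h(a)` (`Gc`), `σ = ±1` the sign of `f_a` on the gap,
`r = √(σ f_a(x))` (`rt`):
* `gm_numerator` (any field): if `h(−a) = h(a)`,
  `2G·a·X^α = (X²−a²)(Q₊ − Q₋) − a^α(X+a)((X−a)g₊′ − g₊) + (−a)^α(X−a)((X+a)g₋′ − g₋)`;
* `hasDerivAt_phi` — (2.1): for `f = (X − e)g` and `σ f(x) > 0`,
  `d/dx [√(σf(x))/(x − e)] = σ((x−e)g′(x) − g(x)) / (2(x−e)√(σf(x)))`;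
* `hasDerivAt_rho`: `d/da [x^α/√(σ f_a(x))] = a·x^α/((x²−a²)·r)`;
* `gm_identity` + `gm_pointwise` — (2.2): that value equals `(Q₊ − Q₋)(x)/(2G r) + dG`, where `dG`
  is certified (`hasDerivAt_Galpha`) to be the `x`-derivative at `x` of
  `G_α(y) = σ(−(a^α/G)·√(σf_a(y))/(y−a) + ((−a)^α/G)·√(σf_a(y))/(y+a))`; and
  `sigma_part_eq_sum`: `(Q₊ − Q₋)(x)/(2G) = Σ_{β<2n} M_{αβ} x^β`, `M_{αβ} = [X^β](Q₊ − Q₋)/(2G)`.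
So `∂_a ρ_α = Σ_β M_{αβ} ρ_β + ∂_x G_α` holds pointwise on every gap, in every genus.  What stays
paper-level: the integration steps (rule 3 on boxes / closed cycles) and the degeneration asymptotics
(B) of THEOREM V_∞.  Bearing on the summit statement: none directly (by-product).
-/

open Polynomial Finset

namespace Summit.KontsevichZagierPeriods.KontsevichZagierPeriods.Theorems
namespace SoloBlind
namespace WeilGMPointwise
open WeilTraceGeneral

section algebra
variable {K : Type*} [Field K] (h : K[X]) (a : K)

/-- The family polynomial `f_a = X(X² − a²)h`. -/
noncomputable def fam : K[X] := X * (X ^ 2 - C a ^ 2) * h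

/-- `f_a = (X − a)·g₊`. -/
theorem fam_eq_P : fam h a = (X - C a) * gP h a := by
  rw [X_sub_C_mul_gP]; rfl

/-- `f_a = (X + a)·g₋`. -/
theorem fam_eq_M : fam h a = (X + C a) * gM h a := by
  rw [X_add_C_mul_gM]; rfl

/-- `f_a = (X − (−a))·g₋`. -/
theorem fam_eq_M' : fam h a = (X - C (-a)) * gM h a := by
  rw [map_neg, sub_neg_eq_add, fam_eq_M]

/-- Evaluation of the family polynomial. -/
theorem fam_eval (x : K) : (fam h a).eval x = x * (x ^ 2 - a ^ 2) * h.eval x := by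
  simp [fam]

/-- The constant `G = g₊(a) = g₋(−a) = 2a²h(a)`. -/
noncomputable def Gc : K := 2 * a ^ 2 * h.eval a

/-- GM NUMERATOR IDENTITY (denominators of (A1) cleared): with `G = 2a²h(a)` and `h(−a) = h(a)`,
`2G·a·X^α = (X²−a²)(Q₊ − Q₋) − a^α(X+a)((X−a)g₊′ − g₊) + (−a)^α(X−a)((X+a)g₋′ − g₋)`. -/
theorem gm_numerator (hsym : h.eval (-a) = h.eval a) (α : ℕ) :
    2 * (C a * (C (Gc h a) * X ^ α))
      = (X ^ 2 - C a ^ 2) * (Qq (gP h a) a α - Qq (gM h a) (-a) α)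
        - C a ^ α * (X + C a) * ((X - C a) * derivative (gP h a) - gP h a)
        + (-C a) ^ α * (X - C a) * ((X + C a) * derivative (gM h a) - gM h a) := by
  have hP := reduction (gP h a) a α
  have hM := reduction (gM h a) (-a) α
  rw [gP_eval_pos] at hP
  rw [gM_eval_neg, hsym, map_neg, sub_neg_eq_add] at hM
  unfold Gc
  linear_combination (X + C a) * hP - (X - C a) * hM

/-- Evaluated form: `2G·a·x^α = (x²−a²)(Q₊−Q₋)(x) − a^α(x+a)E₊ + (−a)^α(x−a)E₋` with
`E₊ = (x−a)g₊′(x) − g₊(x)`, `E₋ = (x+a)g₋′(x) − g₋(x)`. -/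
theorem gm_numerator_eval (hsym : h.eval (-a) = h.eval a) (α : ℕ) (x : K) :
    2 * (a * (Gc h a * x ^ α))
      = (x ^ 2 - a ^ 2) * (Qq (gP h a) a α - Qq (gM h a) (-a) α).eval x
        - a ^ α * (x + a) * ((x - a) * (derivative (gP h a)).eval x - (gP h a).eval x)
        + (-a) ^ α * (x - a) * ((x + a) * (derivative (gM h a)).eval x - (gM h a).eval x) := by
  have key := congrArg (eval x) (gm_numerator h a hsym α)
  simp only [eval_mul, eval_ofNat, eval_C, eval_pow, eval_X, eval_sub, eval_add, eval_neg] at key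
  rw [eval_sub]
  exact key

/-- The "Σ-part" as a finite sum: `(Q₊ − Q₋)(x)/(2G) = Σ_{β<n} ([X^β](Q₊−Q₋)/(2G))·x^β` once
`deg(Q₊ − Q₋) < n`, i.e. `M_{αβ} = [X^β](Q₊ − Q₋)/(2G)` are the Gauss–Manin matrix entries. -/
theorem sigma_part_eq_sum (α n : ℕ)
    (hn : (Qq (gP h a) a α - Qq (gM h a) (-a) α).natDegree < n) (x : K) :
    (Qq (gP h a) a α - Qq (gM h a) (-a) α).eval x / (2 * Gc h a)
      = ∑ β ∈ range n, (Qq (gP h a) a α - Qq (gM h a) (-a) α).coeff β / (2 * Gc h a) * x ^ β := by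
  rw [eval_eq_sum_range' hn, sum_div]
  refine sum_congr rfl fun β _ => ?_
  ring

end algebra

section real

variable (σ : ℝ)

/-- (2.1): for `f = (X − e)·g` and a point `x` with `σ·f(x) > 0`,
`d/dx [√(σ f(x))/(x − e)] = σ·((x−e)g′(x) − g(x)) / (2(x−e)√(σ f(x)))`. -/
theorem hasDerivAt_phi (g : ℝ[X]) (e x : ℝ) (hx : 0 < σ * ((X - C e) * g).eval x) :
    HasDerivAt (fun y => Real.sqrt (σ * ((X - C e) * g).eval y) / (y - e))
      (σ * ((x - e) * (derivative g).eval x - g.eval x)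
        / (2 * (x - e) * Real.sqrt (σ * ((X - C e) * g).eval x))) x := by
  have hpe : ((X - C e) * g).eval x = (x - e) * g.eval x := by simp
  have hde : (derivative ((X - C e) * g)).eval x = g.eval x + (x - e) * (derivative g).eval x := by
    simp [derivative_mul]
  have hxe : x - e ≠ 0 := by
    intro h0
    rw [hpe, h0, zero_mul, mul_zero] at hx
    exact lt_irrefl _ hx
  have h1 : HasDerivAt (fun y => σ * ((X - C e) * g).eval y)
      (σ * (derivative ((X - C e) * g)).eval x) x :=
    (((X - C e) * g).hasDerivAt x).const_mul σ
  have h2 := h1.sqrt (ne_of_gt hx)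
  have h3 : HasDerivAt (fun y : ℝ => y - e) 1 x := (hasDerivAt_id x).sub_const e
  have h4 := h2.div h3 hxe
  rw [hde] at h4
  set r := Real.sqrt (σ * ((X - C e) * g).eval x) with hr_def
  have hr : 0 < r := Real.sqrt_pos.mpr hx
  have hr2 : r ^ 2 = σ * ((x - e) * g.eval x) := by rw [hr_def, Real.sq_sqrt hx.le, hpe]
  refine h4.congr_deriv ?_
  have hdiff : (σ * (g.eval x + (x - e) * (derivative g).eval x) / (2 * r) * (x - e) - r * 1) / (x - e) ^ 2
      - σ * ((x - e) * (derivative g).eval x - g.eval x) / (2 * (x - e) * r)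
      = (σ * ((x - e) * g.eval x) - r ^ 2) / (r * (x - e) ^ 2) := by
    field_simp
    ring
  rw [hr2, sub_self, zero_div] at hdiff
  exact sub_eq_zero.mp hdiff

variable (h : ℝ[X]) (a x : ℝ)

/-- `r = √(σ f_a(x))`. -/
noncomputable def rt : ℝ := Real.sqrt (σ * (fam h a).eval x)

/-- `d/da [x^α/√(σ f_a(x))] = a·x^α/((x²−a²)·√(σ f_a(x)))` at a point with `σ f_a(x) > 0`. -/
theorem hasDerivAt_rho (α : ℕ) (hx : 0 < σ * (fam h a).eval x) :
    HasDerivAt (fun b => x ^ α / Real.sqrt (σ * (fam h b).eval x))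
      (a * x ^ α / ((x ^ 2 - a ^ 2) * rt σ h a x)) a := by
  have hfun : (fun b => x ^ α / Real.sqrt (σ * (fam h b).eval x))
      = fun b => x ^ α / Real.sqrt (σ * (x * (x ^ 2 - b ^ 2) * h.eval x)) := by
    funext b; rw [fam_eval]
  have hxP : 0 < σ * (x * (x ^ 2 - a ^ 2) * h.eval x) := by rw [← fam_eval]; exact hx
  have h0 : HasDerivAt (fun b : ℝ => b ^ 2) (2 * a) a := by
    simpa using hasDerivAt_pow 2 a
  have h1 : HasDerivAt (fun b : ℝ => σ * (x * (x ^ 2 - b ^ 2) * h.eval x))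
      (σ * (x * -(2 * a) * h.eval x)) a :=
    (((h0.const_sub (x ^ 2)).const_mul x).mul_const (h.eval x)).const_mul σ
  have h2 := h1.sqrt (ne_of_gt hxP)
  have hr : 0 < Real.sqrt (σ * (x * (x ^ 2 - a ^ 2) * h.eval x)) := Real.sqrt_pos.mpr hxP
  have h3 := (hasDerivAt_const a (x ^ α)).div h2 (ne_of_gt hr)
  have hrt : rt σ h a x = Real.sqrt (σ * (x * (x ^ 2 - a ^ 2) * h.eval x)) := by
    rw [rt, fam_eval]
  rw [hfun, hrt]
  set r := Real.sqrt (σ * (x * (x ^ 2 - a ^ 2) * h.eval x)) with hr_def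
  have hr2 : r ^ 2 = σ * (x * (x ^ 2 - a ^ 2) * h.eval x) := by rw [hr_def, Real.sq_sqrt hxP.le]
  have hf0 : x * (x ^ 2 - a ^ 2) * h.eval x ≠ 0 := by
    intro h0'; rw [h0', mul_zero] at hxP; exact lt_irrefl _ hxP
  have hxa : x ^ 2 - a ^ 2 ≠ 0 := by
    intro h0'; apply hf0; rw [h0']; ring
  have hr0 : r ≠ 0 := ne_of_gt hr
  refine h3.congr_deriv ?_
  have hdiff : (0 * r - x ^ α * (σ * (x * -(2 * a) * h.eval x) / (2 * r))) / r ^ 2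
      - a * x ^ α / ((x ^ 2 - a ^ 2) * r)
      = a * x ^ α * (σ * (x * (x ^ 2 - a ^ 2) * h.eval x) - r ^ 2) / (r ^ 3 * (x ^ 2 - a ^ 2)) := by
    field_simp
    ring
  have hz : σ * (x * (x ^ 2 - a ^ 2) * h.eval x) - r ^ 2 = 0 := sub_eq_zero.mpr hr2.symm
  rw [hz, mul_zero, zero_div] at hdiff
  exact sub_eq_zero.mp hdiff

/-- The value `dφ_e` of (2.1) for `f_a = (X − e)·g` (`e = ±a`, `g = g±`), with `r = √(σ f_a(x))`. -/
noncomputable def dphi (g : ℝ[X]) (e : ℝ) : ℝ :=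
  σ * ((x - e) * (derivative g).eval x - g.eval x) / (2 * (x - e) * rt σ h a x)

/-- The exact part `G_α(y) = σ(−(a^α/G)·√(σf_a(y))/(y−a) + ((−a)^α/G)·√(σf_a(y))/(y+a))`. -/
noncomputable def Galpha (α : ℕ) (y : ℝ) : ℝ :=
  σ * (-(a ^ α / Gc h a) * (Real.sqrt (σ * (fam h a).eval y) / (y - a))
    + ((-a) ^ α / Gc h a) * (Real.sqrt (σ * (fam h a).eval y) / (y - -a)))

/-- Its derivative value at `x`: `dG = σ(−(a^α/G)·dφ_a + ((−a)^α/G)·dφ_{−a})`. -/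
noncomputable def dG (α : ℕ) : ℝ :=
  σ * (-(a ^ α / Gc h a) * dphi σ h a x (gP h a) a + ((-a) ^ α / Gc h a) * dphi σ h a x (gM h a) (-a))

/-- `G_α` has derivative `dG` at every point `x` of a gap (`σ f_a(x) > 0`). -/
theorem hasDerivAt_Galpha (α : ℕ) (hx : 0 < σ * (fam h a).eval x) :
    HasDerivAt (Galpha σ h a α) (dG σ h a x α) x := by
  have hP : 0 < σ * ((X - C a) * gP h a).eval x := by rw [← fam_eq_P]; exact hx
  have hM : 0 < σ * ((X - C (-a)) * gM h a).eval x := by rw [← fam_eq_M']; exact hx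
  have dP := hasDerivAt_phi σ (gP h a) a x hP
  have dM := hasDerivAt_phi σ (gM h a) (-a) x hM
  rw [← fam_eq_P] at dP
  rw [← fam_eq_M'] at dM
  have key := ((dP.const_mul (-(a ^ α / Gc h a))).add (dM.const_mul ((-a) ^ α / Gc h a))).const_mul σ
  unfold Galpha dG dphi rt
  exact key

/-- THE POINTWISE GM IDENTITY as an identity of real numbers:
`a·x^α/((x²−a²)r) = (Q₊ − Q₋)(x)/(2G r) + dG` (needs `a ≠ 0`, `h(a) ≠ 0`, `h(−a) = h(a)`, `σ f_a(x) > 0`). -/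
theorem gm_identity (α : ℕ) (hσ : σ = 1 ∨ σ = -1) (ha : a ≠ 0) (hha : h.eval a ≠ 0)
    (hsym : h.eval (-a) = h.eval a) (hx : 0 < σ * (fam h a).eval x) :
    a * x ^ α / ((x ^ 2 - a ^ 2) * rt σ h a x)
      = (Qq (gP h a) a α - Qq (gM h a) (-a) α).eval x / (2 * Gc h a * rt σ h a x)
        + dG σ h a x α := by
  have key := gm_numerator_eval h a hsym α x
  have hr : 0 < rt σ h a x := Real.sqrt_pos.mpr hx
  have hf0 : x * (x ^ 2 - a ^ 2) * h.eval x ≠ 0 := by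
    intro h0; rw [fam_eval, h0, mul_zero] at hx; exact lt_irrefl _ hx
  have hx0 : x ≠ 0 := by intro h0; apply hf0; rw [h0]; ring
  have hxa : x ^ 2 - a ^ 2 ≠ 0 := by intro h0; apply hf0; rw [h0]; ring
  have hxma : x - a ≠ 0 := by
    intro h0; apply hxa; have : x = a := sub_eq_zero.mp h0; rw [this]; ring
  have hxpa : x - -a ≠ 0 := by
    intro h0; apply hxa; have : x = -a := sub_eq_zero.mp h0; rw [this]; ring
  have hxpa' : x + a ≠ 0 := by rwa [sub_neg_eq_add] at hxpa
  have hG : Gc h a ≠ 0 := by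
    unfold Gc; exact mul_ne_zero (mul_ne_zero two_ne_zero (pow_ne_zero 2 ha)) hha
  have hr0 : rt σ h a x ≠ 0 := ne_of_gt hr
  set r := rt σ h a x with hr_def
  set q := (Qq (gP h a) a α - Qq (gM h a) (-a) α).eval x with hq_def
  set EP := (x - a) * (derivative (gP h a)).eval x - (gP h a).eval x with hEP
  set EM := (x + a) * (derivative (gM h a)).eval x - (gM h a).eval x with hEM
  have hq : q = (2 * (a * (Gc h a * x ^ α)) + a ^ α * (x + a) * EP - (-a) ^ α * (x - a) * EM)
      / (x ^ 2 - a ^ 2) := by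
    rw [eq_div_iff hxa]
    linear_combination (-1 : ℝ) * key
  unfold dG dphi
  rw [← hr_def, hq]
  have hEM' : (x - -a) * (derivative (gM h a)).eval x - (gM h a).eval x = EM := by
    rw [hEM, sub_neg_eq_add]
  rw [hEM']
  rcases hσ with hs | hs
  · subst hs
    field_simp
    ring
  · subst hs
    field_simp
    ring

/-- (2.2) POINTWISE, every genus: on a gap (`σ f_a(x) > 0`), `∂_a[x^α/√(σf_a(x))]` equals
`(Q₊−Q₋)(x)/(2G√(σf_a(x))) + (∂_x G_α)(x)`, and `G_α` has exactly that derivative at `x`. -/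
theorem gm_pointwise (α : ℕ) (hσ : σ = 1 ∨ σ = -1) (ha : a ≠ 0) (hha : h.eval a ≠ 0)
    (hsym : h.eval (-a) = h.eval a) (hx : 0 < σ * (fam h a).eval x) :
    HasDerivAt (fun b => x ^ α / Real.sqrt (σ * (fam h b).eval x))
        ((Qq (gP h a) a α - Qq (gM h a) (-a) α).eval x / (2 * Gc h a * rt σ h a x)
          + dG σ h a x α) a
      ∧ HasDerivAt (Galpha σ h a α) (dG σ h a x α) x :=
  ⟨(hasDerivAt_rho σ h a x α hx).congr_deriv (gm_identity σ h a x α hσ ha hha hsym hx),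
   hasDerivAt_Galpha σ h a x α hx⟩

end real

end WeilGMPointwise
end SoloBlind
end Summit.KontsevichZagierPeriods.KontsevichZagierPeriods.Theorems
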